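import Summits.QuantumFields.YangMills.Theses.SmallCircleAnchor
import Summits.QuantumFields.YangMills.Theorems.SmallCircleAnchorEndpointTransfer

/-!
# Crux `AdiabaticContinuity` (stmt-QuantumFields-11142), line `registered`, stub R = `stub_deformationRemoval` —
lead certificates (continuation lead c1, 2026-08-17)

Sorry-free bookkeeping about the registered stub statement `DeformationRemoval` (Leg B of the
adiabatic path: deformation removal on the symmetric torus `ℤ_L × (ℤ/L)³`, `s ∈ [0, E β]`), copied
VERBATIM from the registered skeleton `Cruxes/AdiabaticContinuity/Lines/birth.lean` (sha 0ff63db2…).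
Nothing here proves the stub; these are the formal facts the lead's census and PROMOTE.md cite:

* `deformationRemoval_top_slice` — the `s = E β` slice of R's conclusion is R's hypothesis (so all
  content of R is the range `0 ≤ s < E β`);
* `deformationRemoval_of_nonpos_schedule` — ADVERSARIAL-SCHEDULE AUDIT: R quantifies over every
  `E : ℝ → ℝ`; for schedules with `E β ≤ 0` the conclusion is vacuous or the top slice, so R holds
  there outright — negative / zero schedules hide neither a counterexample nor content;
* `uniformLatticeGap_of_legB` — STRENGTH: the Leg-B family (R's conclusion) for a schedule that is
  `≥ 0` beyond the threshold yields, through its `s = 0` end and the PROVED route item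
  `EndpointTransfer` (`endpointTransfer_proof`, stmt-QuantumFields-11145), the body of the route's
  rank-0 target `UniformLatticeGap` for the representation `r`;
* `uniformLatticeGap_of_deformationRemoval` — hence R turns the corner's output (clustering of the
  fully deformed symmetric torus for `β ≥ β₂`, which the line obtains from the anchor via A* and the
  landed corner p147338) into `UniformLatticeGap(r)`: R is at least as strong as
  "corner ⟹ weak-coupling volume-uniform lattice mass gap for `r`".
-/

namespace Summit.QuantumFields.YangMills.Cruxes.AdiabaticContinuity.Birth.CertR

open scoped BigOperators Topology Manifold Classical MeasureTheory ProbabilityTheory Matrix InnerProductSpace ComplexConjugate ContinuousMap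
open Filter Set Function TopologicalSpace MeasureTheory

/-- **Stub R — deformation removal at zero temperature (Leg B).** For every `G, r`, abelianising `V`,
every schedule `E` and threshold `β₂`: if for all `β ≥ β₂` the fully deformed (`s = E(β)`) theory on the
symmetric torus `ℤ_L × (ℤ/L)³` clusters uniformly in `L`, then there is `β₃` such that for all `β ≥ β₃`
ONE rate `m > 0` clusters the `(L, s·V)`-theory uniformly in `L` for EVERY `s ∈ [0, E(β)]` — down to the
undeformed Wilson torus `s = 0` (whence `UniformLatticeGap` by the proved support `EndpointTransfer`).
(At zero temperature the pinning of Polyakov lines of length `L → ∞` is a boundary-like perturbation of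
an unbroken-centre bulk; kill: a bulk first-order transition in `s`.) -/
def DeformationRemoval : Prop :=
  ∀ (G : Type) [Group G] [TopologicalSpace G] [IsTopologicalGroup G] [CompactSpace G],
    Literature.MathematicalPhysics.QuantumFieldTheory.IsCompactSimpleLieGroup G →
    letI : MeasurableSpace G := borel G; haveI : BorelSpace G := ⟨rfl⟩;
    ∀ (r : Literature.MathematicalPhysics.QuantumFieldTheory.LatticeRep G) (V : G → ℝ),
    (Continuous V ∧ (∀ a g : G, V (a * g * a⁻¹) = V g) ∧ ∃ g₀ : G, (∀ g : G, V g₀ ≤ V g) ∧ (∀ g : G, V g = V g₀ → ∃ a : G, g = a * g₀ * a⁻¹) ∧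
      (∀ a b : G, a * g₀ = g₀ * a → b * g₀ = g₀ * b → a * b = b * a)) →
    let Cl := fun (τ : ℕ → ℕ) (s β m : ℝ) =>
      ∀ w : ℕ, ∃ C : ℝ, ∀ (L : ℕ) [NeZero L] [NeZero (τ L)],
      let St := ZMod (τ L) × (Fin 3 → ZMod L);
      let Cfg := St × Option (Fin 3) → G;
      let ν : MeasureTheory.Measure Cfg := MeasureTheory.Measure.pi fun _ => Literature.MathematicalPhysics.QuantumFieldTheory.haarProbability G;
      let sh : St → Option (Fin 3) → St := fun x μ => Option.elim μ (x.1 + 1, x.2) fun i => (x.1, x.2 + Pi.single i 1);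
      let pl : Cfg → St → Option (Fin 3) → Option (Fin 3) → G := fun U x μ κ => U (x, μ) * U (sh x μ, κ) * (U (sh x κ, μ))⁻¹ * (U (x, κ))⁻¹;
      let act : Cfg → ℝ := fun U => β * ∑ x : St, ∑ i : Fin 3, (r.ρ (pl U x none (some i))).trace.re + β * ∑ x : St, ∑ q : {q : Fin 3 × Fin 3 // q.1 < q.2}, (r.ρ (pl U x (some q.1.1) (some q.1.2))).trace.re;
      let P : Cfg → (Fin 3 → ZMod L) → G := fun U x => (List.ofFn fun t : Fin (τ L) => U ((((t : ℕ) : ZMod (τ L)), x), none)).prod;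
      let wgt : Cfg → ℝ := fun U => Real.exp (act U - s * ∑ x : Fin 3 → ZMod L, V (P U x));
      let Ex : (Cfg → ℝ) → ℝ := fun F => (∫ U, F U * wgt U ∂ν) / (∫ U, wgt U ∂ν);
      let σ : ℕ → Cfg → Cfg := fun n U p => U ((p.1.1, p.1.2 + Pi.single 0 (n : ZMod L)), p.2);
      ∀ (c : Fin 3 → ZMod L),
      let Loc := fun F : Cfg → ℝ => Measurable F ∧ (∀ U, |F U| ≤ 1) ∧ ∀ U U', (∀ p, (∀ i : Fin 3, (p.1.2 i - c i).val ≤ w) → U p = U' p) → F U = F U';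
      ∀ F₁ F₂ : Cfg → ℝ, Loc F₁ → Loc F₂ → ∀ n : ℕ, 2 * n < L →
        |Ex (fun U => F₁ U * F₂ (σ n U)) - Ex F₁ * Ex (fun U => F₂ (σ n U))| ≤ C * Real.exp (-(m * n));
    ∀ (E : ℝ → ℝ) (β₂ : ℝ),
      (∀ β : ℝ, β₂ ≤ β → ∃ m : ℝ, 0 < m ∧ Cl (fun L => L) (E β) β m) →
      ∃ β₃ : ℝ, ∀ β : ℝ, β₃ ≤ β → ∃ m : ℝ, 0 < m ∧
        ∀ s : ℝ, 0 ≤ s → s ≤ E β → Cl (fun L => L) s β m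

/-- **Top slice.** R with its conclusion cut down to the single value `s = E β` holds by handing the
hypothesis back (`β₃ := β₂`, same rate): the content of R is the range `0 ≤ s < E β`. [folklore] -/
theorem deformationRemoval_top_slice :
  ∀ (G : Type) [Group G] [TopologicalSpace G] [IsTopologicalGroup G] [CompactSpace G],
    Literature.MathematicalPhysics.QuantumFieldTheory.IsCompactSimpleLieGroup G →
    letI : MeasurableSpace G := borel G; haveI : BorelSpace G := ⟨rfl⟩;
    ∀ (r : Literature.MathematicalPhysics.QuantumFieldTheory.LatticeRep G) (V : G → ℝ),
    (Continuous V ∧ (∀ a g : G, V (a * g * a⁻¹) = V g) ∧ ∃ g₀ : G, (∀ g : G, V g₀ ≤ V g) ∧ (∀ g : G, V g = V g₀ → ∃ a : G, g = a * g₀ * a⁻¹) ∧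
      (∀ a b : G, a * g₀ = g₀ * a → b * g₀ = g₀ * b → a * b = b * a)) →
    let Cl := fun (τ : ℕ → ℕ) (s β m : ℝ) =>
      ∀ w : ℕ, ∃ C : ℝ, ∀ (L : ℕ) [NeZero L] [NeZero (τ L)],
      let St := ZMod (τ L) × (Fin 3 → ZMod L);
      let Cfg := St × Option (Fin 3) → G;
      let ν : MeasureTheory.Measure Cfg := MeasureTheory.Measure.pi fun _ => Literature.MathematicalPhysics.QuantumFieldTheory.haarProbability G;
      let sh : St → Option (Fin 3) → St := fun x μ => Option.elim μ (x.1 + 1, x.2) fun i => (x.1, x.2 + Pi.single i 1);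
      let pl : Cfg → St → Option (Fin 3) → Option (Fin 3) → G := fun U x μ κ => U (x, μ) * U (sh x μ, κ) * (U (sh x κ, μ))⁻¹ * (U (x, κ))⁻¹;
      let act : Cfg → ℝ := fun U => β * ∑ x : St, ∑ i : Fin 3, (r.ρ (pl U x none (some i))).trace.re + β * ∑ x : St, ∑ q : {q : Fin 3 × Fin 3 // q.1 < q.2}, (r.ρ (pl U x (some q.1.1) (some q.1.2))).trace.re;
      let P : Cfg → (Fin 3 → ZMod L) → G := fun U x => (List.ofFn fun t : Fin (τ L) => U ((((t : ℕ) : ZMod (τ L)), x), none)).prod;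
      let wgt : Cfg → ℝ := fun U => Real.exp (act U - s * ∑ x : Fin 3 → ZMod L, V (P U x));
      let Ex : (Cfg → ℝ) → ℝ := fun F => (∫ U, F U * wgt U ∂ν) / (∫ U, wgt U ∂ν);
      let σ : ℕ → Cfg → Cfg := fun n U p => U ((p.1.1, p.1.2 + Pi.single 0 (n : ZMod L)), p.2);
      ∀ (c : Fin 3 → ZMod L),
      let Loc := fun F : Cfg → ℝ => Measurable F ∧ (∀ U, |F U| ≤ 1) ∧ ∀ U U', (∀ p, (∀ i : Fin 3, (p.1.2 i - c i).val ≤ w) → U p = U' p) → F U = F U';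
      ∀ F₁ F₂ : Cfg → ℝ, Loc F₁ → Loc F₂ → ∀ n : ℕ, 2 * n < L →
        |Ex (fun U => F₁ U * F₂ (σ n U)) - Ex F₁ * Ex (fun U => F₂ (σ n U))| ≤ C * Real.exp (-(m * n));
    ∀ (E : ℝ → ℝ) (β₂ : ℝ),
      (∀ β : ℝ, β₂ ≤ β → ∃ m : ℝ, 0 < m ∧ Cl (fun L => L) (E β) β m) →
      ∃ β₃ : ℝ, ∀ β : ℝ, β₃ ≤ β → ∃ m : ℝ, 0 < m ∧
        ∀ s : ℝ, s = E β → Cl (fun L => L) s β m := by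
  intro G _ _ _ _ _ r V _ Cl E β₂ h
  refine ⟨β₂, fun β hβ => ?_⟩
  obtain ⟨m, hm, hc⟩ := h β hβ
  exact ⟨m, hm, fun s hs => hs ▸ hc⟩

/-- **Adversarial-schedule audit.** R quantifies over EVERY schedule `E : ℝ → ℝ` (no `E ≥ ε₁` guard);
for a schedule with `E β ≤ 0` everywhere the conclusion `∀ s, 0 ≤ s → s ≤ E β → …` is either vacuous
(`E β < 0`) or the top slice (`s = 0 = E β`), so R restricted to such schedules is a theorem: they carry
neither a cheap counterexample nor any content. [folklore] -/
theorem deformationRemoval_of_nonpos_schedule :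
  ∀ (G : Type) [Group G] [TopologicalSpace G] [IsTopologicalGroup G] [CompactSpace G],
    Literature.MathematicalPhysics.QuantumFieldTheory.IsCompactSimpleLieGroup G →
    letI : MeasurableSpace G := borel G; haveI : BorelSpace G := ⟨rfl⟩;
    ∀ (r : Literature.MathematicalPhysics.QuantumFieldTheory.LatticeRep G) (V : G → ℝ),
    (Continuous V ∧ (∀ a g : G, V (a * g * a⁻¹) = V g) ∧ ∃ g₀ : G, (∀ g : G, V g₀ ≤ V g) ∧ (∀ g : G, V g = V g₀ → ∃ a : G, g = a * g₀ * a⁻¹) ∧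
      (∀ a b : G, a * g₀ = g₀ * a → b * g₀ = g₀ * b → a * b = b * a)) →
    let Cl := fun (τ : ℕ → ℕ) (s β m : ℝ) =>
      ∀ w : ℕ, ∃ C : ℝ, ∀ (L : ℕ) [NeZero L] [NeZero (τ L)],
      let St := ZMod (τ L) × (Fin 3 → ZMod L);
      let Cfg := St × Option (Fin 3) → G;
      let ν : MeasureTheory.Measure Cfg := MeasureTheory.Measure.pi fun _ => Literature.MathematicalPhysics.QuantumFieldTheory.haarProbability G;
      let sh : St → Option (Fin 3) → St := fun x μ => Option.elim μ (x.1 + 1, x.2) fun i => (x.1, x.2 + Pi.single i 1);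
      let pl : Cfg → St → Option (Fin 3) → Option (Fin 3) → G := fun U x μ κ => U (x, μ) * U (sh x μ, κ) * (U (sh x κ, μ))⁻¹ * (U (x, κ))⁻¹;
      let act : Cfg → ℝ := fun U => β * ∑ x : St, ∑ i : Fin 3, (r.ρ (pl U x none (some i))).trace.re + β * ∑ x : St, ∑ q : {q : Fin 3 × Fin 3 // q.1 < q.2}, (r.ρ (pl U x (some q.1.1) (some q.1.2))).trace.re;
      let P : Cfg → (Fin 3 → ZMod L) → G := fun U x => (List.ofFn fun t : Fin (τ L) => U ((((t : ℕ) : ZMod (τ L)), x), none)).prod;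
      let wgt : Cfg → ℝ := fun U => Real.exp (act U - s * ∑ x : Fin 3 → ZMod L, V (P U x));
      let Ex : (Cfg → ℝ) → ℝ := fun F => (∫ U, F U * wgt U ∂ν) / (∫ U, wgt U ∂ν);
      let σ : ℕ → Cfg → Cfg := fun n U p => U ((p.1.1, p.1.2 + Pi.single 0 (n : ZMod L)), p.2);
      ∀ (c : Fin 3 → ZMod L),
      let Loc := fun F : Cfg → ℝ => Measurable F ∧ (∀ U, |F U| ≤ 1) ∧ ∀ U U', (∀ p, (∀ i : Fin 3, (p.1.2 i - c i).val ≤ w) → U p = U' p) → F U = F U';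
      ∀ F₁ F₂ : Cfg → ℝ, Loc F₁ → Loc F₂ → ∀ n : ℕ, 2 * n < L →
        |Ex (fun U => F₁ U * F₂ (σ n U)) - Ex F₁ * Ex (fun U => F₂ (σ n U))| ≤ C * Real.exp (-(m * n));
    ∀ (E : ℝ → ℝ) (β₂ : ℝ), (∀ β : ℝ, E β ≤ 0) →
      (∀ β : ℝ, β₂ ≤ β → ∃ m : ℝ, 0 < m ∧ Cl (fun L => L) (E β) β m) →
      ∃ β₃ : ℝ, ∀ β : ℝ, β₃ ≤ β → ∃ m : ℝ, 0 < m ∧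
        ∀ s : ℝ, 0 ≤ s → s ≤ E β → Cl (fun L => L) s β m := by
  intro G _ _ _ _ _ r V _ Cl E β₂ hE h
  refine ⟨β₂, fun β hβ => ?_⟩
  obtain ⟨m, hm, hc⟩ := h β hβ
  refine ⟨m, hm, fun s hs0 hs1 => ?_⟩
  have hs : s = E β := le_antisymm hs1 ((hE β).trans hs0)
  exact hs ▸ hc

/-- **Strength of Leg B: its `s = 0` end is the route's rank-0 target for `r`.** If beyond a threshold
`β₃` the schedule is non-negative and the Leg-B family clusters (R's conclusion), then the body of
`UniformLatticeGap` holds for the representation `r` — by instantiating `s = 0`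
(`simp only [zero_mul, sub_zero]` turns the weight `exp(act − 0·ΣV(P))` into the undeformed Wilson
weight) and the proved route item `EndpointTransfer` (`endpointTransfer_proof`). [folklore] -/
theorem uniformLatticeGap_of_legB :
  ∀ (G : Type) [Group G] [TopologicalSpace G] [IsTopologicalGroup G] [CompactSpace G],
    Literature.MathematicalPhysics.QuantumFieldTheory.IsCompactSimpleLieGroup G →
    letI : MeasurableSpace G := borel G; haveI : BorelSpace G := ⟨rfl⟩;
    ∀ (r : Literature.MathematicalPhysics.QuantumFieldTheory.LatticeRep G) (V : G → ℝ),
    (Continuous V ∧ (∀ a g : G, V (a * g * a⁻¹) = V g) ∧ ∃ g₀ : G, (∀ g : G, V g₀ ≤ V g) ∧ (∀ g : G, V g = V g₀ → ∃ a : G, g = a * g₀ * a⁻¹) ∧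
      (∀ a b : G, a * g₀ = g₀ * a → b * g₀ = g₀ * b → a * b = b * a)) →
    let Cl := fun (τ : ℕ → ℕ) (s β m : ℝ) =>
      ∀ w : ℕ, ∃ C : ℝ, ∀ (L : ℕ) [NeZero L] [NeZero (τ L)],
      let St := ZMod (τ L) × (Fin 3 → ZMod L);
      let Cfg := St × Option (Fin 3) → G;
      let ν : MeasureTheory.Measure Cfg := MeasureTheory.Measure.pi fun _ => Literature.MathematicalPhysics.QuantumFieldTheory.haarProbability G;
      let sh : St → Option (Fin 3) → St := fun x μ => Option.elim μ (x.1 + 1, x.2) fun i => (x.1, x.2 + Pi.single i 1);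
      let pl : Cfg → St → Option (Fin 3) → Option (Fin 3) → G := fun U x μ κ => U (x, μ) * U (sh x μ, κ) * (U (sh x κ, μ))⁻¹ * (U (x, κ))⁻¹;
      let act : Cfg → ℝ := fun U => β * ∑ x : St, ∑ i : Fin 3, (r.ρ (pl U x none (some i))).trace.re + β * ∑ x : St, ∑ q : {q : Fin 3 × Fin 3 // q.1 < q.2}, (r.ρ (pl U x (some q.1.1) (some q.1.2))).trace.re;
      let P : Cfg → (Fin 3 → ZMod L) → G := fun U x => (List.ofFn fun t : Fin (τ L) => U ((((t : ℕ) : ZMod (τ L)), x), none)).prod;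
      let wgt : Cfg → ℝ := fun U => Real.exp (act U - s * ∑ x : Fin 3 → ZMod L, V (P U x));
      let Ex : (Cfg → ℝ) → ℝ := fun F => (∫ U, F U * wgt U ∂ν) / (∫ U, wgt U ∂ν);
      let σ : ℕ → Cfg → Cfg := fun n U p => U ((p.1.1, p.1.2 + Pi.single 0 (n : ZMod L)), p.2);
      ∀ (c : Fin 3 → ZMod L),
      let Loc := fun F : Cfg → ℝ => Measurable F ∧ (∀ U, |F U| ≤ 1) ∧ ∀ U U', (∀ p, (∀ i : Fin 3, (p.1.2 i - c i).val ≤ w) → U p = U' p) → F U = F U';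
      ∀ F₁ F₂ : Cfg → ℝ, Loc F₁ → Loc F₂ → ∀ n : ℕ, 2 * n < L →
        |Ex (fun U => F₁ U * F₂ (σ n U)) - Ex F₁ * Ex (fun U => F₂ (σ n U))| ≤ C * Real.exp (-(m * n));
    ∀ (E : ℝ → ℝ) (β₃ : ℝ), (∀ β : ℝ, β₃ ≤ β → 0 ≤ E β) →
      (∀ β : ℝ, β₃ ≤ β → ∃ m : ℝ, 0 < m ∧
        ∀ s : ℝ, 0 ≤ s → s ≤ E β → Cl (fun L => L) s β m) →
      ∃ β₀ : ℝ, ∀ β : ℝ, β₀ ≤ β → ∃ m : ℝ, 0 < m ∧ ∃ S₁ : ℕ,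
        ∀ A B : Literature.MathematicalPhysics.QuantumFieldTheory.YMSpecies G, ∃ C : ℝ, ∀ S n : ℕ, S₁ ≤ S → n ≤ S →
          |Literature.MathematicalPhysics.QuantumFieldTheory.latticeConnectedCorr r.ρ β (2 * S + 1) A.F B.F n| ≤
            C * Real.exp (-(m * n)) := by
  intro G _ _ _ _ hG r V _ Cl E β₃ hE h
  refine Summit.QuantumFields.YangMills.Theorems.SmallCircleAnchor.endpointTransfer_proof G hG r
    ⟨β₃, fun β hβ => ?_⟩
  obtain ⟨m, hm, hs⟩ := h β hβ
  have h0 := hs 0 le_rfl (hE β hβ)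
  refine ⟨m, hm, fun w => ?_⟩
  obtain ⟨C, hC⟩ := h0 w
  refine ⟨C, fun L hL => ?_⟩
  simpa only [zero_mul, sub_zero] using @hC L hL hL

/-- **R carries target strength.** `DeformationRemoval` turns the corner's output — clustering of the
fully deformed symmetric torus for `β ≥ β₂` along a non-negative schedule — into the body of the
route's rank-0 target `UniformLatticeGap` for `r` (via `uniformLatticeGap_of_legB`). [folklore] -/
theorem uniformLatticeGap_of_deformationRemoval (hR : DeformationRemoval) :
  ∀ (G : Type) [Group G] [TopologicalSpace G] [IsTopologicalGroup G] [CompactSpace G],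
    Literature.MathematicalPhysics.QuantumFieldTheory.IsCompactSimpleLieGroup G →
    letI : MeasurableSpace G := borel G; haveI : BorelSpace G := ⟨rfl⟩;
    ∀ (r : Literature.MathematicalPhysics.QuantumFieldTheory.LatticeRep G) (V : G → ℝ),
    (Continuous V ∧ (∀ a g : G, V (a * g * a⁻¹) = V g) ∧ ∃ g₀ : G, (∀ g : G, V g₀ ≤ V g) ∧ (∀ g : G, V g = V g₀ → ∃ a : G, g = a * g₀ * a⁻¹) ∧
      (∀ a b : G, a * g₀ = g₀ * a → b * g₀ = g₀ * b → a * b = b * a)) →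
    let Cl := fun (τ : ℕ → ℕ) (s β m : ℝ) =>
      ∀ w : ℕ, ∃ C : ℝ, ∀ (L : ℕ) [NeZero L] [NeZero (τ L)],
      let St := ZMod (τ L) × (Fin 3 → ZMod L);
      let Cfg := St × Option (Fin 3) → G;
      let ν : MeasureTheory.Measure Cfg := MeasureTheory.Measure.pi fun _ => Literature.MathematicalPhysics.QuantumFieldTheory.haarProbability G;
      let sh : St → Option (Fin 3) → St := fun x μ => Option.elim μ (x.1 + 1, x.2) fun i => (x.1, x.2 + Pi.single i 1);
      let pl : Cfg → St → Option (Fin 3) → Option (Fin 3) → G := fun U x μ κ => U (x, μ) * U (sh x μ, κ) * (U (sh x κ, μ))⁻¹ * (U (x, κ))⁻¹;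
      let act : Cfg → ℝ := fun U => β * ∑ x : St, ∑ i : Fin 3, (r.ρ (pl U x none (some i))).trace.re + β * ∑ x : St, ∑ q : {q : Fin 3 × Fin 3 // q.1 < q.2}, (r.ρ (pl U x (some q.1.1) (some q.1.2))).trace.re;
      let P : Cfg → (Fin 3 → ZMod L) → G := fun U x => (List.ofFn fun t : Fin (τ L) => U ((((t : ℕ) : ZMod (τ L)), x), none)).prod;
      let wgt : Cfg → ℝ := fun U => Real.exp (act U - s * ∑ x : Fin 3 → ZMod L, V (P U x));
      let Ex : (Cfg → ℝ) → ℝ := fun F => (∫ U, F U * wgt U ∂ν) / (∫ U, wgt U ∂ν);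
      let σ : ℕ → Cfg → Cfg := fun n U p => U ((p.1.1, p.1.2 + Pi.single 0 (n : ZMod L)), p.2);
      ∀ (c : Fin 3 → ZMod L),
      let Loc := fun F : Cfg → ℝ => Measurable F ∧ (∀ U, |F U| ≤ 1) ∧ ∀ U U', (∀ p, (∀ i : Fin 3, (p.1.2 i - c i).val ≤ w) → U p = U' p) → F U = F U';
      ∀ F₁ F₂ : Cfg → ℝ, Loc F₁ → Loc F₂ → ∀ n : ℕ, 2 * n < L →
        |Ex (fun U => F₁ U * F₂ (σ n U)) - Ex F₁ * Ex (fun U => F₂ (σ n U))| ≤ C * Real.exp (-(m * n));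
    ∀ (E : ℝ → ℝ) (β₂ : ℝ), (∀ β : ℝ, 0 ≤ E β) →
      (∀ β : ℝ, β₂ ≤ β → ∃ m : ℝ, 0 < m ∧ Cl (fun L => L) (E β) β m) →
      ∃ β₀ : ℝ, ∀ β : ℝ, β₀ ≤ β → ∃ m : ℝ, 0 < m ∧ ∃ S₁ : ℕ,
        ∀ A B : Literature.MathematicalPhysics.QuantumFieldTheory.YMSpecies G, ∃ C : ℝ, ∀ S n : ℕ, S₁ ≤ S → n ≤ S →
          |Literature.MathematicalPhysics.QuantumFieldTheory.latticeConnectedCorr r.ρ β (2 * S + 1) A.F B.F n| ≤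
            C * Real.exp (-(m * n)) := by
  intro G _ _ _ _ hG r V hV Cl E β₂ hE hcorner
  obtain ⟨β₃, h⟩ := hR G hG r V hV E β₂ hcorner
  exact uniformLatticeGap_of_legB G hG r V hV E β₃ (fun β _ => hE β) h

end Summit.QuantumFields.YangMills.Cruxes.AdiabaticContinuity.Birth.CertR
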